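import Mathlib.FieldTheory.Galois.Profinite
import Mathlib.FieldTheory.AbsoluteGaloisGroup
import Mathlib.FieldTheory.IntermediateField.Adjoin.Basic
import Literature.NumberTheory.LocalFields.PadicFiniteSubextensions
import Literature.AnabelianGeometry.AbsoluteAnabelian.SecondCountableExtension
import HarnessLib

/-!
# The absolute Galois group of `ℚ_p` is second countable ("Galois-countable")

Mochizuki, *Inter-universal Teichmüller theory I*, kurims manuscript (May 2020), §2, Remark 2.5.3 (i)
(T1) p. 52: a topological group is *Galois-countable* if "its topology admits a countable basis"
[Mathlib `SecondCountableTopology`]; Remark 2.5.3 (ii) (E1) p. 53 records this for absolute Galois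
groups of fields "of countable cardinality" (tree: `Literature.IUT.HodgeTheaters.Rmk253.
countableFieldGaloisSecondCountable_holds`, abc-iut-L5-t6).  The base fields of [SemiAnbd] §6 /
[IUTchI]–[IUTchIII] at bad places are finite extensions `K` of `ℚ_p` — UNCOUNTABLE fields — for which
(E1) as printed does not apply; the countable basis of `G_K` comes instead from the classical
finiteness theorem "a `p`-adic field has only finitely many extensions of bounded degree"
(M. Krasner; S. Lang, *Algebraic Number Theory*, II §5 Prop. 14), PROVED in the tree from Mathlib
alone as `Literature.NumberTheory.LocalFields.finite_setOf_intermediateField_finrank_le`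
(abc-iut-S4, `PadicFiniteSubextensions.lean`). [cite: Mochizuki2012, IUTchI Rmk 2.5.3 (i) (T1) p.52]

This PROOF-ONLY file (abc-iut cell, prover abc-iut-w5-d040; piece «GaloisCountable-GQp»; no
definition, no named fact, no instance) proves:

* `countable_setOf_finiteDimensional_intermediateField_padic` — the finite subextensions
  `ℚ_p ⊆ E ⊆ Q̄_p` (`Q̄_p = PadicAlgCl p = AlgebraicClosure ℚ_[p]`) form a COUNTABLE set (union over
  the degree bound `d` of the finite sets of Krasner's theorem);
* `secondCountableTopology_galQp` — `G_{ℚ_p} = Gal(Q̄_p/ℚ_p)` (Mathlib: `Q̄_p ≃ₐ[ℚ_p] Q̄_p` with the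
  Krull topology; reducibly the abc-iut interfaces' `GQp p` and Mathlib's
  `Field.absoluteGaloisGroup ℚ_[p]`) is second countable: the open subgroups `Gal(Q̄_p/E)`, `E`
  finite over `ℚ_p`, are a countable family with trivial intersection (every `x ∈ Q̄_p` lies in the
  finite extension `ℚ_p⟮x⟯`), so the tree's `secondCountableTopology_of_iInf_eq_bot` (abc-iut-L5-t6:
  a compact group with a countable separating family of open subgroups has a countable basis)
  applies;
* `secondCountableTopology_absoluteGaloisGroup_padic` — the same for `Field.absoluteGaloisGroup ℚ_[p]`;
* `secondCountableTopology_fixingSubgroup_padic` — hence `G_K = Gal(Q̄_p/K)` is second countable for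
  every subextension `K ⊆ Q̄_p` (the §6 interfaces' `TemperedCurve.GK`), and
  `secondCountableTopology_subgroup_galQp` for every subgroup of `G_{ℚ_p}`.

These are exactly the inputs of the interface fields `TemperedArithmeticGroup.secondCountableTopology`
([SemiAnbd] Ex. 3.10 / [IUTchI] Rmk 2.5.3 (i) (T1), abc-iut-L3-t2) and
`TemperedCurve.GroupLevelData.secondCountableTopology` (abc-iut-w5-d111) at a GENUINE `p`-adic base
field.  Classical field theory; nothing of [IUTchI] is asserted; no side is taken on [IUTchIII]
Cor. 3.12.
-/

noncomputable section

open Topology TopologicalSpace IntermediateField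

namespace Literature.NumberTheory.LocalFields

variable (p : ℕ) [Fact p.Prime]

/-- **The finite subextensions of `Q̄_p / ℚ_p` form a countable set**: the union over `d : ℕ` of the
FINITE sets `{E | [E:ℚ_p] ≤ d}` of Krasner's finiteness theorem
(`finite_setOf_intermediateField_finrank_le`). (Lang, *Algebraic Number Theory*, II §5 Prop. 14.)
[cite: Mochizuki2012, IUTchI Rmk 2.5.3 (i) (T1) p.52] -/
theorem countable_setOf_finiteDimensional_intermediateField_padic :
    {E : IntermediateField ℚ_[p] (PadicAlgCl p) | FiniteDimensional ℚ_[p] E}.Countable := by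
  have hsub : {E : IntermediateField ℚ_[p] (PadicAlgCl p) | FiniteDimensional ℚ_[p] E} ⊆
      ⋃ d : ℕ, {E : IntermediateField ℚ_[p] (PadicAlgCl p) | FiniteDimensional ℚ_[p] E ∧
        Module.finrank ℚ_[p] E ≤ d} := by
    intro E hE
    exact Set.mem_iUnion.mpr ⟨Module.finrank ℚ_[p] E, hE, le_rfl⟩
  exact (Set.countable_iUnion fun d =>
    (finite_setOf_intermediateField_finrank_le p d).countable).mono hsub

/-- An automorphism of `Q̄_p / ℚ_p` fixing every FINITE subextension pointwise is the identity:
every `x ∈ Q̄_p` is algebraic, so `ℚ_p⟮x⟯` is such a subextension. [folklore]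
[cite: Mochizuki2012, IUTchI Rmk 2.5.3 (i) (T1) p.52] -/
theorem algEquiv_eq_one_of_forall_mem_fixingSubgroup (σ : PadicAlgCl p ≃ₐ[ℚ_[p]] PadicAlgCl p)
    (hσ : ∀ E : IntermediateField ℚ_[p] (PadicAlgCl p), FiniteDimensional ℚ_[p] E →
      σ ∈ E.fixingSubgroup) : σ = 1 := by
  apply AlgEquiv.ext
  intro x
  have hx : IsIntegral ℚ_[p] x := Algebra.IsIntegral.isIntegral x
  have hfd : FiniteDimensional ℚ_[p] ℚ_[p]⟮x⟯ := adjoin.finiteDimensional hx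
  have hmem := hσ ℚ_[p]⟮x⟯ hfd
  rw [IntermediateField.mem_fixingSubgroup_iff] at hmem
  exact hmem x (mem_adjoin_simple_self ℚ_[p] x)

/-- **`G_{ℚ_p}` is second countable ("Galois-countable", [IUTchI] Rmk 2.5.3 (i) (T1))**, for
Mathlib's `Gal(Q̄_p/ℚ_p) = (Q̄_p ≃ₐ[ℚ_p] Q̄_p)` with the Krull topology (reducibly the abc-iut §6
interface's `GQp p`): the open subgroups `Gal(Q̄_p/E)`, `E/ℚ_p` finite, form a countable separating
family in a compact group. PROVED from Krasner's finiteness theorem; no named fact.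
[cite: Mochizuki2012, IUTchI Rmk 2.5.3 (i) (T1) p.52] -/
theorem secondCountableTopology_galQp :
    SecondCountableTopology (PadicAlgCl p ≃ₐ[ℚ_[p]] PadicAlgCl p) := by
  let S := {E : IntermediateField ℚ_[p] (PadicAlgCl p) | FiniteDimensional ℚ_[p] E}
  haveI : Countable S := (countable_setOf_finiteDimensional_intermediateField_padic p).to_subtype
  refine AnabelianGeometry.AbsoluteAnabelian.secondCountableTopology_of_iInf_eq_bot
    (fun E : S => (E.1.fixingSubgroup : Subgroup (PadicAlgCl p ≃ₐ[ℚ_[p]] PadicAlgCl p)))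
    (fun E => ?_) (fun σ hσ => ?_)
  · haveI : FiniteDimensional ℚ_[p] E.1 := E.2
    exact IntermediateField.fixingSubgroup_isOpen E.1
  · exact algEquiv_eq_one_of_forall_mem_fixingSubgroup p σ fun E hE => hσ ⟨E, hE⟩

/-- The same for Mathlib's `Field.absoluteGaloisGroup ℚ_[p]` (definitionally `Q̄_p ≃ₐ[ℚ_p] Q̄_p` with
the Krull topology). [cite: Mochizuki2012, IUTchI Rmk 2.5.3 (i) (T1) p.52] -/
theorem secondCountableTopology_absoluteGaloisGroup_padic :
    SecondCountableTopology (Field.absoluteGaloisGroup ℚ_[p]) :=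
  secondCountableTopology_galQp p

/-- Every subgroup of `G_{ℚ_p}` (with the subspace topology) is second countable — in particular
every closed subgroup `G_K`, decomposition group, etc. [cite: Mochizuki2012, IUTchI Rmk 2.5.3 (i) (T1) p.52] -/
theorem secondCountableTopology_subgroup_galQp (H : Subgroup (PadicAlgCl p ≃ₐ[ℚ_[p]] PadicAlgCl p)) :
    SecondCountableTopology H := by
  haveI := secondCountableTopology_galQp p
  exact TopologicalSpace.Subtype.secondCountableTopology _

/-- **`G_K = Gal(Q̄_p/K)` is second countable** for every subextension `ℚ_p ⊆ K ⊆ Q̄_p` — the §6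
interfaces' `G_K := Fix(K) ≤ G_{ℚ_p}` ([SemiAnbd] §6 p. 69) at a GENUINE `p`-adic base field, i.e. the
input of `TemperedArithmeticGroup.secondCountableTopology` / `GroupLevelData.secondCountableTopology`
on the Galois side. [cite: Mochizuki2012, IUTchI Rmk 2.5.3 (i) (T1) p.52] -/
theorem secondCountableTopology_fixingSubgroup_padic (K : IntermediateField ℚ_[p] (PadicAlgCl p)) :
    SecondCountableTopology K.fixingSubgroup :=
  secondCountableTopology_subgroup_galQp p K.fixingSubgroup

/-- Product form: `G_{ℚ_p} × Δ` is second countable for every second countable `Δ` (the shape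
`Π := G_{ℚ_p} × Δ` of the cell's §6 toy models). [cite: Mochizuki2012, IUTchI Rmk 2.5.3 (i) (T1) p.52] -/
theorem secondCountableTopology_galQp_prod (Δ : Type*) [TopologicalSpace Δ]
    [SecondCountableTopology Δ] :
    SecondCountableTopology ((PadicAlgCl p ≃ₐ[ℚ_[p]] PadicAlgCl p) × Δ) := by
  haveI := secondCountableTopology_galQp p
  infer_instance

end Literature.NumberTheory.LocalFields

end
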